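import Summits.Ventures.PercRepro.RankLevelSetExplicitLin2Key
import Summits.Ventures.PercRepro.RankLevelSetExplicitLin2RowTwelve

/-!
# PercRepro — THE LEVEL-13 ROW OF C-025 FROM THE CHAIN'S OWN FLOOR `p ≥ 85 609` (p9, S4)

`proofs/SUBCLAIM-S4-p9.md` §S4.3⁗. THEOREM U states level `13` from `p ≥ 212 993` (`q·2^{q+1} + 1`). The assembled
inequality `(P_d)` of its chain holds, exactly evaluated, at EVERY core corank `14 ≤ d ≤ 8205` from `p = 85 609` — and fails at
`p = 85 608` (corank `5 106`): the integer key `KeyP 13 85609 d` (RankLevelSetExplicitLin2Key) is checked by the kernel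
at the 8 192 coranks (`decide`, 2 chunks of 4 096), the key is monotone in the rank (`keyP_mono`), and the wrapper
`c025_level_succ_of_keyP_row` assembles the level from the level-12 row `c025_twelve_from_40204` (RankLevelSetExplicitLin2RowTwelve):
**`c025_thirteen_from_85609 (M) (p) (hp : 85609 ≤ p) : RLS M p 13`** — the level-13 threshold `212 993` of THEOREM U
becomes `85 609` (`0.402·q·2^{q+1}`), the floor of the counting method itself. Axioms: standard.
-/

open scoped Matroid

namespace PercRepro

namespace ThmN

namespace Explicit

/-- The key row at `(q, p) = (13, 85 609)`, chunk 1 of 2: coranks `14 … 4109`, by the kernel. -/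
theorem key_thirteen_row_1 : ∀ t < 4096, KeyP 13 85609 (14 + t) := by decide +kernel

/-- The key row at `(q, p) = (13, 85 609)`, chunk 2 of 2: coranks `4110 … 8205`, by the kernel. -/
theorem key_thirteen_row_2 : ∀ t < 4096, KeyP 13 85609 (14 + (4096 + t)) := by decide +kernel

/-- **THE KEY ROW AT `(q, p) = (13, 85 609)`**: `KeyP 13 85609 d` at every corank `14 ≤ d ≤ 8205` (the 2 chunks). -/
theorem key_thirteen_row : ∀ t < 8192, KeyP 13 85609 (14 + t) :=
  ball_lt_add (fun t => KeyP 13 85609 (14 + t)) 4096 4096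
    (key_thirteen_row_1) key_thirteen_row_2

/-- **THE FLOOR IS EXACT**: the key FAILS at `p = 85 608`, corank `5 106` (the big class's saturation corank), by the kernel. -/
theorem key_thirteen_sharp : ¬ KeyP 13 85608 5106 := by decide +kernel

end Explicit

variable {α : Type}

/-- **THE LEVEL-13 ROW FROM `85 609`**: C-025 at level `13` for every finite matroid and every `p ≥ 85 609` — the key row
at `85 609`, its monotonicity in `p`, the wrapper `c025_level_succ_of_keyP_row` (`N₁(13) = 16 778`, tail `24 659`) and
the level-12 row `c025_twelve_from_40204` (RankLevelSetExplicitLin2RowTwelve) at `p − 1`. -/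
theorem c025_thirteen_from_85609 (M : Matroid α) [M.Finite] (p : ℕ) (hp : 85609 ≤ p) : RLS M p 13 :=
  c025_level_succ_of_keyP_row 12 (by norm_num) 85609 (by norm_num) (by norm_num) Explicit.key_thirteen_row
    (fun M' _ p' hp' => c025_twelve_from_40204 M' p' (by omega)) M p hp

/-- The same in the literal `C025` body: `phiK p 13 · #U(p, 13) ≤ #Y(p, 13)` for every finite matroid and every `p ≥ 85 609`. -/
theorem c025_thirteen_from_85609' (M : Matroid α) [M.Finite] (p : ℕ) (hp : 85609 ≤ p) :
    phiK p 13 * ({A : Set α | A ⊆ M.E ∧ M.eRk A = (p : ℕ∞) ∧ M.eRk (M.E \ A) = (13 : ℕ∞)}.ncard : ℚ) ≤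
      ({A : Set α | A ⊆ M.E ∧ (13 : ℕ∞) < M.eRk A ∧ M.eRk A < (p : ℕ∞)}.ncard : ℚ) :=
  c025_thirteen_from_85609 M p hp

end ThmN

end PercRepro
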